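import Mathlib
import Summits.KontsevichZagierPeriods.Zeta5Search.BrickTwoDigitMain
import Summits.KontsevichZagierPeriods.Zeta5Search.BrickDigitStepDZero

/-!
# BrickResidueLawMain — THEOREM 7 LEMMA 2 (ii), the RESIDUE LAW at EVERY level for MAIN cells:
`r_j^{(s)}(n) ≡ λ_j·r̃_{j′}^{(s)}(n′) (mod p^Λ)`, `s ∈ {0} ∪ [1,A]`, `λ_j = c_{j,A}(n)/c̃_{j′,A}(n′)` (cell zeta5-irr)

HONEST FRAMING: systematic search; no irrationality claim unless certified. INSTRUMENT lemmas of the ζ(5)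
census cell zeta5-irr (HOME `run/shared/lean/pub/zeta5-irr/`; memo `zi-p2/probes/B8/thm7/THEOREM7.md` §1 LEMMA 2:
«(★) F_K(pT) = c_{K,A}(N)·G_K(T)·U_K(T) … (ii) RESIDUE LAW: if Λ ≤ A − B then for every s ∈ {0} ∪ [1,A]:
v(r_K^{(s)}(N) − λ_K·r̃_{K′}^{(s)}(N′)) ≥ Λ» — here for MAIN cells (c_h = c_a = c_c = 0, δ_b = 0), where `G_K = F̃_{K′}`
has no gained or lost member and NO level hypothesis is needed; the gained-member types a/b/c of THEOREM 7/8's ° cells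
are NOT in this file). Nothing here is about ζ(5); no irrationality content; filing moves no rung. Filed by the engine
seat zi-eng (g8): `BrickDigitStripMain.laurent_rescale_eq_sum` ((★) for main cells: `rescale_p F_j = C(λ)·F̃_J·U`,
`U(0) = 1`, `[T^g]U ∈ p^gℤ_(p)`), `BrickLambda.lambda_congr` (`λ ∈ ℤ_(p)`), `BrickTopKummer.laurent_valuation_abs`
(LEMMA 1 (iii) at level `Λ − 1`) and the harmonic blocks (`p^{Λs}H_j^{(s)} ≡ p^{(Λ−1)s}H_{j′}^{(s)} (mod p^Λ)`).

## The statements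

`p` odd prime, `2B ≤ A`, `n = n₀ + Np`, `j = j₀ + Jp` with `j₀ ≤ n₀`, `n₀ + j₀ < p`, `n₀ + (n₀ − j₀) < p`, `J ≤ N`,
`N < p^{L+1}` (so `n′ = N` has level `L = Λ − 1` and `n` has level `Λ = L + 1`), `ε = 0` or `p ∤ n − 2j`;
`λ := cTop A B ε n j / cTop A B 0 N J`. In depth form (`d = A − s`, `laurent … d = c_{·,A−d}`):

* `residueLaw_main`: **`v(p^{(L+1)d}·laurent A B ε n j d − λ·(p^{Ld}·laurent A B 0 N J d)) ≤ exp(−(L+1))`**;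
* `residueLaw_main_zero`: **`v(p^{(L+1)A}·cellZero A B ε n j − λ·(p^{LA}·cellZero A B 0 N J)) ≤ exp(−(L+1))`**;
* helpers: `cong_mul_le` (congruence calculus mod `p^m`), `pow_mul_hsum_sub_le`, `level_hsum_sub_le`
  (`v(p^{(L+1)s}H_j^{(s)} − p^{Ls}H_{⌊j/p⌋}^{(s)}) ≤ exp(−(L+1))`, `s ≥ 1`), `level_laurent_integral`, `lambda_main`.
-/

namespace Summit.KontsevichZagierPeriods.Zeta5Search.BrickResidueLawMain

open Finset Nat WithZero
open Summit.KontsevichZagierPeriods.Zeta5Search.BrickTopCoefficient (cTop)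
open Summit.KontsevichZagierPeriods.Zeta5Search.BrickLaurent (laurent cell laurent_zero)
open Summit.KontsevichZagierPeriods.Zeta5Search.BrickPartialFractions (cellZero)
open Summit.KontsevichZagierPeriods.Zeta5Search.ScaledSeries (IsSlopeInt)
open Summit.KontsevichZagierPeriods.Zeta5Search.BrickTopKummer (laurent_valuation_abs)
open Summit.KontsevichZagierPeriods.Zeta5Search.BrickDigitStripMain (laurent_rescale_eq_sum)
open Summit.KontsevichZagierPeriods.Zeta5Search.BrickLambda (le_one_of_cong lambda_congr cTop_zero_ne_zero)
open Summit.KontsevichZagierPeriods.Zeta5Search.BrickHarmonicBlocks (hsum blockSigma hsum_add pow_mul_hsum_mul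
  padicValuation_blockSigma_le_one)
open Summit.KontsevichZagierPeriods.Zeta5Search.BrickDigitStepDZero (cellZero_eq hsum_valuation)
open Literature.NumberTheory.LFunctions (padicValuation_natCast_eq_one)

noncomputable section

variable {p : ℕ} [Fact p.Prime]

/-! ## Congruence calculus mod `p^m` and the harmonic factor -/

/-- `x₁ ≡ y₁`, `x₂ ≡ y₂ (mod g)`, `x₁, y₂ ∈ ℤ_(p)` ⇒ `x₁x₂ ≡ y₁y₂ (mod g)`. -/
theorem cong_mul_le {x₁ y₁ x₂ y₂ : ℚ} {g : WithZero (Multiplicative ℤ)}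
    (h₁ : Rat.padicValuation p (x₁ - y₁) ≤ g) (h₂ : Rat.padicValuation p (x₂ - y₂) ≤ g)
    (hx₁ : Rat.padicValuation p x₁ ≤ 1) (hy₂ : Rat.padicValuation p y₂ ≤ 1) :
    Rat.padicValuation p (x₁ * x₂ - y₁ * y₂) ≤ g := by
  rw [show x₁ * x₂ - y₁ * y₂ = x₁ * (x₂ - y₂) + (x₁ - y₁) * y₂ by ring]
  refine Valuation.map_add_le _ ?_ ?_
  · rw [map_mul]
    calc _ ≤ 1 * g := mul_le_mul' hx₁ h₂
      _ = g := one_mul g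
  · rw [map_mul]
    calc _ ≤ g * 1 := mul_le_mul' h₁ hy₂
      _ = g := mul_one g

/-- `v(p^s·H_j^{(s)} − H_{⌊j/p⌋}^{(s)}) ≤ exp(−s)`: the blocks `σ_s(b)` and the tail `Σ_{r ≤ j₀}(j′p + r)^{−s}` are
`p`-integral. -/
theorem pow_mul_hsum_sub_le (s j : ℕ) :
    Rat.padicValuation p ((p : ℚ) ^ s * hsum s j - hsum s (j / p)) ≤ exp (-(s : ℤ)) := by
  have hp : p.Prime := Fact.out
  have hps : Rat.padicValuation p ((p : ℚ) ^ s) = exp (-(s : ℤ)) := by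
    rw [map_pow, Rat.padicValuation_self, ← exp_nsmul, nsmul_eq_mul, mul_neg_one]
  rw [show hsum s j = hsum s (j / p * p + j % p) by rw [Nat.div_add_mod'], hsum_add, mul_add, pow_mul_hsum_mul,
    add_assoc, add_sub_cancel_left]
  refine Valuation.map_add_le _ ?_ ?_
  · rw [map_mul, hps]
    calc _ ≤ exp (-(s : ℤ)) * 1 :=
          mul_le_mul' le_rfl (Valuation.map_sum_le _ fun b _ => padicValuation_blockSigma_le_one s b)
      _ = _ := mul_one _
  · rw [map_mul, hps]
    calc _ ≤ exp (-(s : ℤ)) * 1 := mul_le_mul' le_rfl (Valuation.map_sum_le _ fun r hr => ?_)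
      _ = _ := mul_one _
    have hr' := mem_Icc.1 hr
    have hjp := Nat.mod_lt j hp.pos
    rw [one_div, map_inv₀, map_pow, padicValuation_natCast_eq_one (fun h => ?_), one_pow, inv_one]
    have : p ∣ r := (Nat.dvd_add_right (dvd_mul_left p (j / p))).1 h
    exact absurd (Nat.le_of_dvd (by omega) this) (by omega)

/-- **`p^{(L+1)s}H_j^{(s)} ≡ p^{Ls}H_{⌊j/p⌋}^{(s)} (mod p^{L+1})`** for `s ≥ 1`. -/
theorem level_hsum_sub_le {s : ℕ} (hs : 1 ≤ s) (L j : ℕ) :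
    Rat.padicValuation p ((p : ℚ) ^ ((L + 1) * s) * hsum s j - (p : ℚ) ^ (L * s) * hsum s (j / p)) ≤
      exp (-((L : ℤ) + 1)) := by
  have hs1 : (1 : ℤ) ≤ s := by exact_mod_cast hs
  rw [show (p : ℚ) ^ ((L + 1) * s) * hsum s j - (p : ℚ) ^ (L * s) * hsum s (j / p) =
      (p : ℚ) ^ (L * s) * ((p : ℚ) ^ s * hsum s j - hsum s (j / p)) by
    rw [show (L + 1) * s = L * s + s by ring, pow_add]; ring, map_mul, map_pow, Rat.padicValuation_self, ← exp_nsmul]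
  refine (mul_le_mul' le_rfl (pow_mul_hsum_sub_le s j)).trans ?_
  rw [← exp_add, exp_le_exp, nsmul_eq_mul]
  push_cast
  nlinarith [mul_nonneg (Int.natCast_nonneg L) (sub_nonneg.2 hs1)]

/-- LEMMA 1 (iii) one level down: `p^{Le}·[T^e]F̃_J^{(N)} ∈ ℤ_(p)` for `J ≤ N < p^{L+1}`. -/
theorem level_laurent_integral (hp2 : p ≠ 2) {A B : ℕ} (hAB : 2 * B ≤ A) {L N J : ℕ} (hN : N < p ^ (L + 1))
    (hJN : J ≤ N) (e : ℕ) : Rat.padicValuation p ((p : ℚ) ^ (L * e) * laurent A B 0 N J e) ≤ 1 := by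
  rw [map_mul, map_pow, Rat.padicValuation_self, ← exp_nsmul]
  refine (mul_le_mul' le_rfl (laurent_valuation_abs hp2 hAB (L := L) (ε := 0) hN hJN (Or.inr rfl) e)).trans ?_
  rw [← exp_add, ← exp_zero, exp_le_exp, nsmul_eq_mul]
  push_cast
  linarith

/-- `p^{Ls}·H_J^{(s)} ∈ ℤ_(p)` for `J < p^{L+1}`. -/
theorem level_hsum_integral {L J : ℕ} (hJ : J < p ^ (L + 1)) (s : ℕ) :
    Rat.padicValuation p ((p : ℚ) ^ (L * s) * hsum s J) ≤ 1 := by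
  rw [map_mul, map_pow, Rat.padicValuation_self, ← exp_nsmul]
  refine (mul_le_mul' le_rfl (hsum_valuation hJ s)).trans ?_
  rw [← exp_add, ← exp_zero, exp_le_exp, nsmul_eq_mul]
  push_cast
  linarith

/-! ## The residue law for main cells -/

section main

variable (hp2 : p ≠ 2) {A B ε N n₀ J j₀ n j L : ℕ} (hAB : 2 * B ≤ A) (hn : n = n₀ + N * p) (hj : j = j₀ + J * p)
  (hN : N < p ^ (L + 1)) (hj₀ : j₀ ≤ n₀) (h1 : n₀ + j₀ < p) (h2 : n₀ + (n₀ - j₀) < p) (hJN : J ≤ N)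
  (hcen : ε = 0 ∨ ¬ (p : ℤ) ∣ (n : ℤ) - 2 * j)
include hp2 hn hj hj₀ h1 h2 hJN

/-- **The multiplier** `λ_j = c_{j,A}(n)/c̃_{J,A}(N)` lies in `ℤ_(p)` and is `≡ c_{j₀,A}(n₀) (mod p)`. -/
theorem lambda_main : Rat.padicValuation p (cTop A B ε n j / cTop A B 0 N J) ≤ 1 ∧
    Rat.padicValuation p (cTop A B ε n j / cTop A B 0 N J - cTop A B ε n₀ j₀) < 1 := by
  refine lambda_congr (p := p) hp2 (A := A) (B := B) (ε := ε) hj₀ h1 h2 hJN ?_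
  rw [div_mul_cancel₀ _ (cTop_zero_ne_zero hJN A B), hn, hj]

include hAB hN hcen

/-- **LEMMA 2 (ii), MAIN cells, every level, cells `s ≥ 1` (depth form)**:
`v(p^{(L+1)d}·[T^d]F_j^{(n)} − λ_j·p^{Ld}·[T^d]F̃_J^{(N)}) ≤ exp(−(L+1))`. -/
theorem residueLaw_main (d : ℕ) :
    Rat.padicValuation p ((p : ℚ) ^ ((L + 1) * d) * laurent A B ε n j d -
      cTop A B ε n j / cTop A B 0 N J * ((p : ℚ) ^ (L * d) * laurent A B 0 N J d)) ≤ exp (-((L : ℤ) + 1)) := by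
  have hp : p.Prime := Fact.out
  have hn₀ : n₀ < p := by omega
  obtain ⟨U, hU0, hUint, lam, hsum, hlam⟩ :=
    laurent_rescale_eq_sum (p := p) hp2 (A := A) (B := B) (ε := ε) hn₀ hj₀ h1 h2 hJN hn hj hcen
  have hjn : j ≤ n := by rw [hn, hj]; nlinarith
  rw [laurent_zero hAB 0 hJN, laurent_zero hAB ε hjn] at hlam
  have hlam1 : Rat.padicValuation p lam ≤ 1 :=
    (lambda_congr (p := p) hp2 (A := A) (B := B) (ε := ε) hj₀ h1 h2 hJN (by rw [hlam, hn, hj])).1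
  have hlam' : cTop A B ε n j / cTop A B 0 N J = lam := by
    rw [← hlam, mul_div_assoc, div_self (cTop_zero_ne_zero hJN A B), mul_one]
  rw [hlam']
  -- the `U`-coefficients pay `p^{(L+1)g}`
  have hU : ∀ g, 1 ≤ g → Rat.padicValuation p ((p : ℚ) ^ (L * g) * PowerSeries.coeff g U) ≤ exp (-((L : ℤ) + 1)) := by
    intro g hg
    have hg1 : (1 : ℤ) ≤ g := by exact_mod_cast hg
    rw [map_mul, map_pow, Rat.padicValuation_self, ← exp_nsmul]
    refine (mul_le_mul' le_rfl (hUint g)).trans ?_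
    rw [← exp_add, exp_le_exp, nsmul_eq_mul]
    push_cast
    nlinarith [mul_nonneg (Int.natCast_nonneg L) (sub_nonneg.2 hg1)]
  -- the two-scale expansion with the `g = 0` term split off
  set S : ℚ := ∑ k ∈ range d, laurent A B 0 N J k * PowerSeries.coeff (d - k) U with hS
  have hd : (p : ℚ) ^ d * laurent A B ε n j d = lam * (S + laurent A B 0 N J d) := by
    rw [hsum d, Finset.Nat.sum_antidiagonal_eq_sum_range_succ
      (fun e g => laurent A B 0 N J e * PowerSeries.coeff g U) d, Finset.sum_range_succ, Nat.sub_self,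
      PowerSeries.coeff_zero_eq_constantCoeff_apply, hU0, mul_one]
  have hPS : (p : ℚ) ^ (L * d) * S =
      ∑ k ∈ range d, ((p : ℚ) ^ (L * k) * laurent A B 0 N J k) * ((p : ℚ) ^ (L * (d - k)) * PowerSeries.coeff (d - k) U) := by
    rw [hS, Finset.mul_sum]
    refine Finset.sum_congr rfl fun k hk => ?_
    have hk' := mem_range.1 hk
    rw [show L * d = L * k + L * (d - k) by rw [← mul_add]; congr 1; omega, pow_add]
    ring
  rw [show (p : ℚ) ^ ((L + 1) * d) * laurent A B ε n j d = (p : ℚ) ^ (L * d) * ((p : ℚ) ^ d * laurent A B ε n j d) by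
      rw [show (L + 1) * d = L * d + d by ring, pow_add, mul_assoc], hd,
    show (p : ℚ) ^ (L * d) * (lam * (S + laurent A B 0 N J d)) - lam * ((p : ℚ) ^ (L * d) * laurent A B 0 N J d) =
      lam * ((p : ℚ) ^ (L * d) * S) by ring, hPS, map_mul]
  calc _ ≤ 1 * exp (-((L : ℤ) + 1)) := mul_le_mul' hlam1 (Valuation.map_sum_le _ fun k hk => by
          have hk' := mem_range.1 hk
          rw [map_mul]
          calc _ ≤ 1 * exp (-((L : ℤ) + 1)) :=
                mul_le_mul' (level_laurent_integral hp2 hAB hN hJN k) (hU (d - k) (by omega))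
            _ = _ := one_mul _)
    _ = _ := one_mul _

/-- **LEMMA 2 (ii), MAIN cells, every level, the harmonic cell `s = 0`**:
`v(p^{(L+1)A}·cell^{(0)}_j(n) − λ_j·p^{LA}·cell̃^{(0)}_J(N)) ≤ exp(−(L+1))`. -/
theorem residueLaw_main_zero :
    Rat.padicValuation p ((p : ℚ) ^ ((L + 1) * A) * cellZero A B ε n j -
      cTop A B ε n j / cTop A B 0 N J * ((p : ℚ) ^ (L * A) * cellZero A B 0 N J)) ≤ exp (-((L : ℤ) + 1)) := by
  have hp : p.Prime := Fact.out
  have hJ : j / p = J := by rw [hj, Nat.add_mul_div_right _ _ hp.pos, Nat.div_eq_of_lt (by omega), zero_add]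
  have hJlt : J < p ^ (L + 1) := lt_of_le_of_lt hJN hN
  have hlt1 : exp (-((L : ℤ) + 1)) < 1 := by rw [← exp_zero, exp_lt_exp]; omega
  set r : ℚ := cTop A B ε n j / cTop A B 0 N J with hr
  have hr1 : Rat.padicValuation p r ≤ 1 := (lambda_main hp2 hn hj hj₀ h1 h2 hJN).1
  have hx : (p : ℚ) ^ ((L + 1) * A) * cellZero A B ε n j =
      -∑ s ∈ Icc 1 A, ((p : ℚ) ^ ((L + 1) * (A - s)) * cell A B ε n j s) * ((p : ℚ) ^ ((L + 1) * s) * hsum s j) := by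
    rw [cellZero_eq, mul_neg, Finset.mul_sum]
    congr 1
    refine Finset.sum_congr rfl fun s hs => ?_
    have hs' := mem_Icc.1 hs
    rw [show (p : ℚ) ^ ((L + 1) * A) = (p : ℚ) ^ ((L + 1) * (A - s)) * (p : ℚ) ^ ((L + 1) * s) by
      rw [← pow_add, ← mul_add, Nat.sub_add_cancel hs'.2]]
    ring
  have hy : r * ((p : ℚ) ^ (L * A) * cellZero A B 0 N J) =
      -∑ s ∈ Icc 1 A, (r * ((p : ℚ) ^ (L * (A - s)) * cell A B 0 N J s)) * ((p : ℚ) ^ (L * s) * hsum s J) := by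
    rw [cellZero_eq, mul_neg, mul_neg, Finset.mul_sum, Finset.mul_sum]
    congr 1
    refine Finset.sum_congr rfl fun s hs => ?_
    have hs' := mem_Icc.1 hs
    rw [show (p : ℚ) ^ (L * A) = (p : ℚ) ^ (L * (A - s)) * (p : ℚ) ^ (L * s) by
      rw [← pow_add, ← mul_add, Nat.sub_add_cancel hs'.2]]
    ring
  rw [hx, hy, neg_sub_neg, ← Finset.sum_sub_distrib]
  refine Valuation.map_sum_le _ fun s hs => ?_
  have hs' := mem_Icc.1 hs
  rw [Valuation.map_sub_swap]
  have hlaw := residueLaw_main hp2 hAB hn hj hN hj₀ h1 h2 hJN hcen (A - s)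
  have hH := level_hsum_sub_le (p := p) hs'.1 L j
  rw [hJ] at hH
  have hy₁ : Rat.padicValuation p (r * ((p : ℚ) ^ (L * (A - s)) * cell A B 0 N J s)) ≤ 1 := by
    rw [map_mul]; exact mul_le_one' hr1 (level_laurent_integral hp2 hAB hN hJN (A - s))
  exact cong_mul_le hlaw hH (le_one_of_cong (lt_of_le_of_lt hlaw hlt1) hy₁) (level_hsum_integral hJlt s)

end main

end

end Summit.KontsevichZagierPeriods.Zeta5Search.BrickResidueLawMain
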